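import Summits.ResolutionOfSingularities.ResolutionOfSingularities.Theorems.PurelyInseparableDim4ResConeHeavyEntryFrame
import HarnessLib
import HarnessLib.Audit.Tags

/-!
# Purely inseparable four-folds — A LOSS-FREE TAIL HAS EVENTUALLY CONSTANT WEIGHTS, every prime `p`, every shade `d`, any `e_G`
# (K2(p) lane, rows B-LF (ii) «the corner ledger of a loss-free tail ends in a multi-twin-plus-passive fixed state»; cell `res-dim4-pi`)

[OURS · counted 0 · cell `res-dim4-pi` · K2(p) lane holder res-dim4-p-12 g5, S4 of 2026-08-29 11:07Z «ROW B-LF (ii): the corner ledger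
⇒ eventually light multi-twin + passive (e-free weights) — owner p-5 / p-2»; seat res-dim4-p-2 g6 (text + census `auto-g6/lossfree.py` first,
bus 11:17Z).]  Nothing here proves any TAIL(p, d, e), K2(7), K2(p) or resolution of singularities in dimension ≥ 4 / characteristic `p` —
NOT proved; a structure theorem about OUR frame's chains.  AI kernel work, weaker than expert review.

THE THEOREM (weights + loss-freeness ONLY; no `e_G`, no `d < p`, no frame, not even FT).  Along a witnessed isolated above-floor `Step0 p`
chain with `x^{r₀} ∣ F₀` and constant shade `d` from `k₀`, suppose the tail is LOSS-FREE from `k₀` (`b k i ≠ 0 → r_k i = 0`: no boundary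
letter is ever translated).  Then the boundary law is the CORNER GAME `r_{k+1} = r_k.update (j k) (|r_k| + d − p)` (`lossfree_update`), a
letter keeps its weight until it is charted again (`lossfree_apply_eq_of_not_charted`), and:
**`lossfree_weights_eventually_constant`** — `∃ K ≥ k₀, ∀ k ≥ K, (c (k+1)).r = (c k).r`.
PROOF.  Write `s_k = |r_k|`, `t = p − d`.  A letter charted at time `κ` carries the weight `s_κ − t` until its next chart, so if the letter
charted at `k` was last charted at `κ < k` then `s_{k+1} = 2 s_k − s_κ`.  Let `V` be the largest value `s` takes infinitely often
(`eventual_max_of_bounded`; `s` is bounded by the band) and go late enough that `s ≤ V` and every letter still being charted has been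
charted since; at a late time with `s_k = V`, `s_{k+1} = 2V − s_κ ≥ V` forces `s_{k+1} = V` and `s_κ = V`; inductively `s ≡ V`, every
charted letter already weighs `V − t`, and the update is the identity.
Consequences (`lossfree_charted_weight`): late charts hit letters of weight exactly `|r| + d − p`; with FT (≥ 2 letters charted for ever)
the frozen end state has `k ≥ 2` ACTIVE letters of a common weight `n` and passive letters of total weight `W` with `(k − 1)·n + W = p − d` —
the «light multi-twin + passive» shapes of the holder's B-LF row (census `lossfree.py`: at every `p ≤ 19` these fixed states are the only
FT-surviving recurrent classes of the loss-free game; at `p = 7`: `(1,1)@(7,6) · (2,2),(1,1,1)@(7,5) · (2,1,1),(2,2,1),(1,1,1,1)@(7,4) ·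
(2,2,1,1),(2,1,1,1),(3,1,1),(2,2,2)@(7,3)`), where the two-slot / C∞ / C∞-PRIME games start.
[cite: CossartJannsenSaito2020, Thm. 3.14, Lemma 13.2] [cite: HauserPerlega2019PRIMS, §2 (transform D' of D)]
bears_on: LADDER-RESOLUTION:D157-DOOR2 (res-dim4-pi · K2(p) · rows B-LF (ii) · loss-free ⇒ weights eventually constant).
Supports stmt-ResolutionOfSingularities-16155 (helper).
-/

set_option linter.dupNamespace false -- mandated namespace of this single-conjunct summit

noncomputable section

namespace Summit.ResolutionOfSingularities.ResolutionOfSingularities.Theorems.PIDim4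

namespace ResCone

open MvPolynomial Finset IsLocalRing
open Literature.AlgebraicGeometry.Resolution
open Literature.AlgebraicGeometry.Resolution.CentreBlowup
open Literature.AlgebraicGeometry.Resolution.Hauser2010
open Literature.AlgebraicGeometry.Resolution.HauserPerlega2019

variable {K : Type} [Field K]

/-- **A bounded sequence of naturals has an eventual maximum that it attains beyond every time.** [folklore] -/
theorem eventual_max_of_bounded (s : ℕ → ℕ) {B : ℕ} (hB : ∀ k, s k ≤ B) :
    ∃ V K₁ : ℕ, (∀ k, K₁ ≤ k → s k ≤ V) ∧ ∀ N, ∃ k, N ≤ k ∧ s k = V := by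
  induction B generalizing s with
  | zero => exact ⟨0, 0, fun k _ => hB k, fun N => ⟨N, le_rfl, Nat.le_zero.mp (hB N)⟩⟩
  | succ B ih =>
    by_cases hio : ∀ N, ∃ k, N ≤ k ∧ s k = B + 1
    · exact ⟨B + 1, 0, fun k _ => hB k, hio⟩
    · push Not at hio
      obtain ⟨N, hN⟩ := hio
      have hB' : ∀ k, s (N + k) ≤ B := fun k => by
        have h1 := hB (N + k)
        have h2 := hN (N + k) (Nat.le_add_right _ _)
        omega
      obtain ⟨V, K₁, hle, hio'⟩ := ih (fun k => s (N + k)) hB'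
      refine ⟨V, N + K₁, fun k hk => ?_, fun M => ?_⟩
      · have := hle (k - N) (by omega)
        rwa [show N + (k - N) = k by omega] at this
      · obtain ⟨k, hk, hsk⟩ := hio' M
        exact ⟨N + k, by omega, hsk⟩

variable {p : ℕ} [Fact p.Prime] [DecidableEq K]

/-- **On a loss-free tail the boundary law is the CORNER GAME `r_{k+1} = r_k.update (j k) (|r_k| + d − p)`** (the filter of the boundary
law is the identity when no boundary letter is translated). [OURS · bookkeeping] [cite: HauserPerlega2019PRIMS, §2 (transform D' of D)] -/
theorem lossfree_update {c : ℕ → State K} {j : ℕ → Fin 4} {b : ℕ → Fin 4 → K}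
    (hc : ∀ k, IsIsolated p (c k).F ∧ Step0 p (c k) (c (k + 1))) (hw : FreeTail.IsWitnessedChain p c j b)
    (hr0 : ∀ e ∈ (c 0).F.support, (c 0).r ≤ e) (hfloor : ∀ k, ordZero (c k).F ≠ p) {k₀ d : ℕ}
    (hshade : ∀ k, k₀ ≤ k → (c k).shade = ((d : ℕ) : ℕ∞))
    (hloss : ∀ k, k₀ ≤ k → ∀ i, b k i ≠ 0 → (c k).r i = 0) {k : ℕ} (hk : k₀ ≤ k) :
    (c (k + 1)).r = (c k).r.update (j k) ((c k).r.degree + d - p) := by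
  obtain ⟨-, hlaw, -, -, -⟩ := tail_weights_laws hc hw hr0 hfloor hshade
  have hfilt : (c k).r.filter (fun i => b k i = 0) = (c k).r := by
    rw [Finsupp.filter_eq_self_iff]
    intro i hi
    by_contra hb
    exact hi (hloss k hk i hb)
  rw [hlaw k hk, hfilt]

/-- **On a loss-free tail a letter keeps its weight until it is charted.** [OURS · bookkeeping] -/
theorem lossfree_apply_eq_of_not_charted {c : ℕ → State K} {j : ℕ → Fin 4} {b : ℕ → Fin 4 → K}
    (hc : ∀ k, IsIsolated p (c k).F ∧ Step0 p (c k) (c (k + 1))) (hw : FreeTail.IsWitnessedChain p c j b)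
    (hr0 : ∀ e ∈ (c 0).F.support, (c 0).r ≤ e) (hfloor : ∀ k, ordZero (c k).F ≠ p) {k₀ d : ℕ}
    (hshade : ∀ k, k₀ ≤ k → (c k).shade = ((d : ℕ) : ℕ∞))
    (hloss : ∀ k, k₀ ≤ k → ∀ i, b k i ≠ 0 → (c k).r i = 0) {a : ℕ} (ha : k₀ ≤ a) {i : Fin 4} :
    ∀ n, (∀ l, a ≤ l → l < a + n → j l ≠ i) → (c (a + n)).r i = (c a).r i := by
  intro n
  induction n with
  | zero => intro _; rfl
  | succ n ih =>
    intro hnot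
    have h1 : (c (a + n)).r i = (c a).r i := ih fun l hl hl' => hnot l hl (by omega)
    have hj : j (a + n) ≠ i := hnot (a + n) (by omega) (by omega)
    rw [show a + (n + 1) = a + n + 1 by ring, lossfree_update hc hw hr0 hfloor hshade hloss (k := a + n) (by omega),
      Finsupp.coe_update, Function.update_of_ne (Ne.symm hj), h1]

/-- **The charted letter is re-born with the newborn weight; the degree follows the corner game**:
`r_{k+1} (j k) = |r_k| + d − p` and `|r_{k+1}| + r_k (j k) = |r_k| + (|r_k| + d − p)`. [OURS · bookkeeping] -/
theorem lossfree_degree_succ {c : ℕ → State K} {j : ℕ → Fin 4} {b : ℕ → Fin 4 → K}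
    (hc : ∀ k, IsIsolated p (c k).F ∧ Step0 p (c k) (c (k + 1))) (hw : FreeTail.IsWitnessedChain p c j b)
    (hr0 : ∀ e ∈ (c 0).F.support, (c 0).r ≤ e) (hfloor : ∀ k, ordZero (c k).F ≠ p) {k₀ d : ℕ}
    (hshade : ∀ k, k₀ ≤ k → (c k).shade = ((d : ℕ) : ℕ∞))
    (hloss : ∀ k, k₀ ≤ k → ∀ i, b k i ≠ 0 → (c k).r i = 0) {k : ℕ} (hk : k₀ ≤ k) :
    (c (k + 1)).r (j k) = (c k).r.degree + d - p ∧
      (c (k + 1)).r.degree + (c k).r (j k) = (c k).r.degree + ((c k).r.degree + d - p) := by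
  have hupd := lossfree_update hc hw hr0 hfloor hshade hloss hk
  refine ⟨by rw [hupd, Finsupp.coe_update, Function.update_self], ?_⟩
  have h1 : ((c k).r.update (j k) ((c k).r.degree + d - p)).degree + (c k).r (j k) =
      ((c k).r.erase (j k)).degree + ((c k).r.degree + d - p) + (c k).r (j k) := by
    rw [Finsupp.update_eq_erase_add_single, map_add, Finsupp.degree_single]
  have h2 : (c k).r.degree = ((c k).r.erase (j k)).degree + (c k).r (j k) := by
    conv_lhs => rw [← Finsupp.erase_add_single (j k) (c k).r]
    rw [map_add, Finsupp.degree_single]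
  rw [hupd, h1, h2]
  ring

/-- **A LOSS-FREE TAIL HAS EVENTUALLY CONSTANT WEIGHTS, every prime `p`, every shade `d`, any `e_G`.**  Along a witnessed isolated
above-floor `Step0 p` chain with `x^{r₀} ∣ F₀` and constant shade `d` from `k₀` on which no boundary letter is ever translated from `k₀`,
the weight vector `r_k` is constant from some time on.  (Proof in the module docstring: `s_{k+1} = 2 s_k − s_κ` for the last chart time
`κ` of the letter charted at `k`, and the largest value taken infinitely often is absorbing.) [OURS]
[cite: CossartJannsenSaito2020, Lemma 13.2, Thm. 3.14] [cite: HauserPerlega2019PRIMS, §2 (transform D' of D)] -/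
theorem lossfree_weights_eventually_constant {c : ℕ → State K} {j : ℕ → Fin 4} {b : ℕ → Fin 4 → K}
    (hc : ∀ k, IsIsolated p (c k).F ∧ Step0 p (c k) (c (k + 1))) (hw : FreeTail.IsWitnessedChain p c j b)
    (hr0 : ∀ e ∈ (c 0).F.support, (c 0).r ≤ e) (hfloor : ∀ k, ordZero (c k).F ≠ p) {k₀ d : ℕ}
    (hshade : ∀ k, k₀ ≤ k → (c k).shade = ((d : ℕ) : ℕ∞))
    (hloss : ∀ k, k₀ ≤ k → ∀ i, b k i ≠ 0 → (c k).r i = 0) :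
    ∃ K₁, k₀ ≤ K₁ ∧ ∀ k, K₁ ≤ k → (c (k + 1)).r = (c k).r := by
  classical
  obtain ⟨-, -, -, hband, -⟩ := tail_weights_laws hc hw hr0 hfloor hshade
  -- the degree sequence from `k₀` on, bounded by the band
  set s : ℕ → ℕ := fun n => (c (k₀ + n)).r.degree with hs
  have hsB : ∀ n, s n ≤ 2 * p := fun n => by
    have := (hband (k₀ + n) (Nat.le_add_right _ _)).2
    show (c (k₀ + n)).r.degree ≤ 2 * p
    omega
  obtain ⟨V, N₁, hle, hio⟩ := eventual_max_of_bounded s hsB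
  -- letters charted finitely often stop being charted; letters charted for ever are charted after any time
  have hletters : ∃ N₂, N₁ ≤ N₂ ∧ ∀ n, N₂ ≤ n → ∃ κ, N₁ ≤ κ ∧ κ < n ∧ j (k₀ + κ) = j (k₀ + n) := by
    -- for each letter: a time after which either it is never charted, or it has been charted since `N₁`
    have hone : ∀ i : Fin 4, ∃ T, N₁ ≤ T ∧ ((∀ n, T ≤ n → j (k₀ + n) ≠ i) ∨ ∃ κ, N₁ ≤ κ ∧ κ < T ∧ j (k₀ + κ) = i) := by
      intro i
      by_cases hfin : ∃ T, ∀ n, T ≤ n → j (k₀ + n) ≠ i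
      · obtain ⟨T, hT⟩ := hfin
        exact ⟨max T N₁, le_max_right _ _, Or.inl fun n hn => hT n (le_trans (le_max_left _ _) hn)⟩
      · push Not at hfin
        obtain ⟨κ, hκ, hjκ⟩ := hfin N₁
        exact ⟨κ + 1, by omega, Or.inr ⟨κ, hκ, by omega, hjκ⟩⟩
    choose T hT using hone
    refine ⟨Finset.univ.sup T ⊔ N₁, le_sup_right, fun n hn => ?_⟩
    have hTn : T (j (k₀ + n)) ≤ n := le_trans (le_trans (Finset.le_sup (Finset.mem_univ _)) le_sup_left) hn
    rcases (hT (j (k₀ + n))).2 with hnever | ⟨κ, hκ, hκT, hjκ⟩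
    · exact absurd rfl (hnever n hTn)
    · exact ⟨κ, hκ, by omega, hjκ⟩
  obtain ⟨N₂, hN₁₂, hlast⟩ := hletters
  -- the LAST chart time before `n` of the letter charted at `n`, and the weight it carries
  have hkey : ∀ n, N₂ ≤ n → ∃ κ, N₁ ≤ κ ∧ κ < n ∧ (c (k₀ + n)).r (j (k₀ + n)) = s κ + d - p := by
    intro n hn
    obtain ⟨κ₀, hκ₀, hκ₀n, hjκ₀⟩ := hlast n hn
    set κ := Nat.findGreatest (fun l => j (k₀ + l) = j (k₀ + n)) (n - 1) with hκdef
    have hPκ : j (k₀ + κ) = j (k₀ + n) := Nat.findGreatest_spec (P := fun l => j (k₀ + l) = j (k₀ + n)) (by omega) hjκ₀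
    have hκ₀le : κ₀ ≤ κ := Nat.le_findGreatest (P := fun l => j (k₀ + l) = j (k₀ + n)) (by omega) hjκ₀
    have hκle : κ ≤ n - 1 := Nat.findGreatest_le _
    have hnone : ∀ l, κ < l → l ≤ n - 1 → j (k₀ + l) ≠ j (k₀ + n) := fun l hl hl' =>
      Nat.findGreatest_is_greatest (P := fun l => j (k₀ + l) = j (k₀ + n)) hl hl'
    refine ⟨κ, by omega, by omega, ?_⟩
    -- the letter was re-born at `κ` with weight `s κ + d − p` and untouched on `(κ, n)`
    have hborn := (lossfree_degree_succ hc hw hr0 hfloor hshade hloss (k := k₀ + κ) (Nat.le_add_right _ _)).1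
    have hkeep := lossfree_apply_eq_of_not_charted hc hw hr0 hfloor hshade hloss (a := k₀ + κ + 1) (by omega)
      (i := j (k₀ + n)) (n - κ - 1) (fun l hl hl' => by
        have := hnone (l - k₀) (by omega) (by omega)
        rwa [show k₀ + (l - k₀) = l by omega] at this)
    rw [show k₀ + κ + 1 + (n - κ - 1) = k₀ + n by omega, ← hPκ, hborn] at hkeep
    rw [← hPκ, hkeep]
  -- the degree recursion `s (n+1) + s κ = 2 s n`
  have hrec : ∀ n, N₂ ≤ n → ∃ κ, N₁ ≤ κ ∧ κ < n ∧ s (n + 1) + s κ = s n + s n := by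
    intro n hn
    obtain ⟨κ, hκ, hκn, hval⟩ := hkey n hn
    have hdeg := (lossfree_degree_succ hc hw hr0 hfloor hshade hloss (k := k₀ + n) (Nat.le_add_right _ _)).2
    have hbn := (hband (k₀ + n) (Nat.le_add_right _ _)).1
    have hbκ := (hband (k₀ + κ) (Nat.le_add_right _ _)).1
    refine ⟨κ, hκ, hκn, ?_⟩
    show (c (k₀ + (n + 1))).r.degree + (c (k₀ + κ)).r.degree = (c (k₀ + n)).r.degree + (c (k₀ + n)).r.degree
    rw [show k₀ + (n + 1) = k₀ + n + 1 by ring]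
    rw [hval] at hdeg
    change (c (k₀ + n + 1)).r.degree + ((c (k₀ + κ)).r.degree + d - p) =
      (c (k₀ + n)).r.degree + ((c (k₀ + n)).r.degree + d - p) at hdeg
    omega
  -- `V` is absorbing from the first late visit on
  obtain ⟨n₀, hn₀, hsn₀⟩ := hio N₂
  have habs : ∀ m, s (n₀ + m) = V := by
    intro m
    induction m with
    | zero => exact hsn₀
    | succ m ih =>
      obtain ⟨κ, hκ, -, hsum⟩ := hrec (n₀ + m) (by omega)
      have h1 := hle κ (by omega)
      have h2 := hle (n₀ + m + 1) (by omega)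
      rw [show n₀ + (m + 1) = n₀ + m + 1 by ring]
      rw [ih] at hsum
      omega
  -- hence every late step re-creates its letter
  refine ⟨k₀ + n₀, Nat.le_add_right _ _, fun k hk => ?_⟩
  obtain ⟨m, rfl⟩ : ∃ m, k = k₀ + (n₀ + m) := ⟨k - k₀ - n₀, by omega⟩
  have e2 : (c (k₀ + (n₀ + m))).r.degree = V := habs m
  have e1 : (c (k₀ + (n₀ + m) + 1)).r.degree = V := by
    have h := habs (m + 1)
    simp only [hs] at h
    rwa [show k₀ + (n₀ + (m + 1)) = k₀ + (n₀ + m) + 1 by ring] at h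
  have hdeg := (lossfree_degree_succ hc hw hr0 hfloor hshade hloss (k := k₀ + (n₀ + m)) (Nat.le_add_right _ _)).2
  have hbn := (hband (k₀ + (n₀ + m)) (Nat.le_add_right _ _)).1
  rw [e1, e2] at hdeg
  -- the charted letter's weight equals the newborn weight
  have hweq : (c (k₀ + (n₀ + m))).r (j (k₀ + (n₀ + m))) = (c (k₀ + (n₀ + m))).r.degree + d - p := by
    rw [e2]; omega
  rw [lossfree_update hc hw hr0 hfloor hshade hloss (k := k₀ + (n₀ + m)) (Nat.le_add_right _ _), ← hweq, Finsupp.update_self]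

/-- **Consequence: every late chart hits a letter of weight exactly `|r| + d − p`** (the newborn weight), and re-creates it. [OURS] -/
theorem lossfree_charted_weight {c : ℕ → State K} {j : ℕ → Fin 4} {b : ℕ → Fin 4 → K}
    (hc : ∀ k, IsIsolated p (c k).F ∧ Step0 p (c k) (c (k + 1))) (hw : FreeTail.IsWitnessedChain p c j b)
    (hr0 : ∀ e ∈ (c 0).F.support, (c 0).r ≤ e) (hfloor : ∀ k, ordZero (c k).F ≠ p) {k₀ d : ℕ}
    (hshade : ∀ k, k₀ ≤ k → (c k).shade = ((d : ℕ) : ℕ∞))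
    (hloss : ∀ k, k₀ ≤ k → ∀ i, b k i ≠ 0 → (c k).r i = 0) :
    ∃ K₁, k₀ ≤ K₁ ∧ ∀ k, K₁ ≤ k → (c (k + 1)).r = (c k).r ∧ (c k).r (j k) = (c k).r.degree + d - p := by
  obtain ⟨K₁, hK₁, hconst⟩ := lossfree_weights_eventually_constant hc hw hr0 hfloor hshade hloss
  refine ⟨K₁, hK₁, fun k hk => ⟨hconst k hk, ?_⟩⟩
  have h := (lossfree_degree_succ hc hw hr0 hfloor hshade hloss (k := k) (by omega)).1
  rw [hconst k hk] at h
  exact h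

end ResCone

end Summit.ResolutionOfSingularities.ResolutionOfSingularities.Theorems.PIDim4

end
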